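import Mathlib
import Summits.ValiantsHypothesis.ValiantsHypothesis.Theorems.LacunarySymmetroidMatrixDescartesStubReverse
import Summits.ValiantsHypothesis.ValiantsHypothesis.Theorems.LacunarySymmetroidMatrixDescartesStubInertiaChain
import Summits.ValiantsHypothesis.ValiantsHypothesis.Theorems.LacunarySymmetroidMatrixDescartesVLawChain

/-!
# `MatrixDescartes` (stmt-ValiantsHypothesis-18050), line `Lift` — the NEGATIVE-MOMENT LAW
# (a K-free two-sided sector law: one negative-definite scale caps the count at `2·n`)

HONEST FRAMING.  Cell `pub-symmetroid`, seat `val-sym-mdr-p2` (gen 10); helper `--supports` the crux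
`Theses.LacunarySymmetroid.MatrixDescartes`, NO closure claim.  A format-level upper bound by sign structure for the
crux's universal class of pivot pencils (`Cruxes/MatrixDescartes/Lines/Lift.lean`: one symmetric pivot `J` at exponent
`e`, PSD letters `P k` at arbitrary exponents on BOTH sides, any number of them).  Nothing here bears on the registered
stub `stub_twoSided` (≅ the crux), on `MatrixDescartes` in its window, `DoorA26`/`DoorA34`, registers, or `VP ≠ VNP`.

**THEOREM (`negMoment_posRoots_le`).**  `F(X) = X^e J + ∑ k, X^{d k} P k`, `J` real symmetric, every `P k ⪰ 0`
(`ι × ι`, any finite letter type `κ`, any exponents, ties allowed).  If at ONE scale `x₀ > 0` the real matrix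
`F(x₀)` is NEGATIVE DEFINITE (`vᵀF(x₀)v < 0` for `v ≠ 0`), then `det F` has at most `card ι` distinct zeros in
`(0, x₀)`, none at `x₀`, and at most `card ι` in `(x₀, ∞)` (`negMoment_posRoots_below_le`, `negMoment_not_isRoot`,
`negMoment_posRoots_above_le`); hence `Z₊ ≤ 2 · card ι`, uniformly in the number of letters and in the exponent
configuration.  The hypothesis forces `J ≺ 0` (`negMoment_pivot_neg`).  Companion `…MomentLawPivot`: `Matrix.PosDef` form,
pivot currency `Pivot.pivotPosRoots e d J P ≤ 2m`, and SHARPNESS (the constant `2·card ι` is attained).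
WHERE IT SITS.  The tree's K-free two-sided laws constrain the exponent CONFIGURATION or letter MAGNITUDES window by
window (`firstRung_oneSided`: one side only, `Z₊ ≤ n`; V-law / fan laws: a lone letter with the largest gap; regime
windows, dominated sign words, Loewner chains); at `m = 2` a negative-semidefinite pivot gives only the K-dependent
`Z₊ ≤ 2K` (`Pivot.DefinitePivot.pivotTwo_posRoots_le_two_mul_of_negSemidef_pivot`).  This law's only hypothesis is
a POINTWISE SIGN CONDITION on the pencil's values; it interpolates the one-sided rung (negative moment at `0⁺`/`∞`).

PROOF (convexity + kernel chain).  For `x > 0`, `F(x) = x^e • H(x)`, `H(x) = J + ∑ k, (x^{d k}/x^e) • P k`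
(`MomentLaw.smul_hform`).  Every Rayleigh form `φ_v(x) = vᵀH(x)v = vᵀJv + ∑ (x^{d k}/x^e)·vᵀP_k v` is CONVEX on
`(0, ∞)` whatever the sign of `J` (integer powers are convex there, Mathlib `convexOn_zpow`; weights `vᵀP_k v ≥ 0`;
`MomentLaw.secant_form`).  If `φ_v(x₀) < 0` for all `v ≠ 0`, non-negativity propagates STRICTLY AWAY from `x₀`:
`x₀ < y < z`, `φ_v(y) ≥ 0 ⇒ φ_v(z) > 0`, and `z < y < x₀`, `φ_v(y) ≥ 0 ⇒ φ_v(z) > 0` (`propagate_above/below`).  This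
directed propagation is exactly the input of the tree's abstract kernel chain (`VLawChain.linearIndependent_of_chain`;
quantitative step as in `StubInertiaChain.quadForm_sum_pos` with Loewner monotonicity replaced by pointwise
propagation: `MomentLaw.quadForm_sum_pos`, `card_le_of_directed`): kernel vectors of `H` at the roots on one side
of `x₀`, ordered away from `x₀`, are linearly independent — at most `card ι` per side.  Elementary given the tree
engines; axioms `propext`, `Classical.choice`, `Quot.sound`.  NOT ASSERTED (located only, memo MOMENT-LAW.md on
the item): the K-free law for a negative-semidefinite pivot WITHOUT a negative moment (`J ⪯ 0 ⇒ Z₊ ≤ 2n`?).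
-/

-- layout Summits/ValiantsHypothesis/ValiantsHypothesis forces the duplicated namespace component
set_option linter.dupNamespace false

namespace Summit.ValiantsHypothesis.ValiantsHypothesis.Theorems.LacunarySymmetroidMatrixDescartes

open Polynomial Matrix Finset
open scoped BigOperators

namespace MomentLaw

/-! ## Engine: the DIRECTED kernel chain (pointwise propagation instead of Loewner monotonicity) -/

section Engine

variable {ι : Type*} [Fintype ι]

/-- **Directed chain, quantitative form.**  `G : ℝ → Matrix ι ι ℝ` symmetric on a set `S`; `rel` an arbitrary
"later than" relation on times; PROPAGATION: for `s, t ∈ S` with `rel s t`, non-negativity of the quadratic form of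
`G s` at a nonzero vector forces strict positivity of the form of `G t` there.  Then for kernel vectors `v j` of
`G (τ j)` (`τ j ∈ S`, `rel (τ i) (τ j)` for `i < j`) forming a linearly independent family, the form of `G s` is
strictly positive at every nonzero-coefficient combination `∑ c i • v i`, for every `s ∈ S` later than all `τ j`.
[folklore] (the tree's `StubInertiaChain.quadForm_sum_pos` with monotonicity replaced by propagation) -/
theorem quadForm_sum_pos (G : ℝ → Matrix ι ι ℝ) (rel : ℝ → ℝ → Prop) (S : Set ℝ)
    (hG : ∀ s ∈ S, (G s).IsSymm)
    (hprop : ∀ s ∈ S, ∀ t ∈ S, rel s t → ∀ x : ι → ℝ, x ≠ 0 →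
      0 ≤ x ⬝ᵥ (G s *ᵥ x) → 0 < x ⬝ᵥ (G t *ᵥ x)) :
    ∀ (k : ℕ) (τ : Fin k → ℝ) (v : Fin k → (ι → ℝ)),
      (∀ j, τ j ∈ S) → (∀ i j : Fin k, i < j → rel (τ i) (τ j)) →
      (∀ j, G (τ j) *ᵥ v j = 0) → LinearIndependent ℝ v →
      ∀ c : Fin k → ℝ, c ≠ 0 → ∀ s ∈ S, (∀ j, rel (τ j) s) →
        0 < (∑ i, c i • v i) ⬝ᵥ (G s *ᵥ ∑ i, c i • v i)
  | 0, _, _, _, _, _, _, c, hc, _, _, _ => absurd (Subsingleton.elim c 0) hc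
  | k + 1, τ, v, hS, hchain, hker, hli, c, hc, s, hs, hrel => by
    -- the combination is nonzero by linear independence
    have hw : ∑ i, c i • v i ≠ 0 := by
      intro h0
      exact hc (funext fun i => Fintype.linearIndependent_iff.1 hli c h0 i)
    have hT : τ (Fin.last k) ∈ S := hS _
    -- at the last kernel time the form is non-negative: it equals the form at the prefix combination
    have hformT : 0 ≤ (∑ i, c i • v i) ⬝ᵥ (G (τ (Fin.last k)) *ᵥ ∑ i, c i • v i) := by
      rw [Fin.sum_univ_castSucc,
        StubInertiaChain.quadForm_add_smul_of_mulVec_eq_zero (hG _ hT) (hker (Fin.last k))]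
      by_cases hc' : (fun i : Fin k => c (Fin.castSucc i)) = 0
      · have hu : ∑ i : Fin k, c (Fin.castSucc i) • v (Fin.castSucc i) = 0 :=
          Finset.sum_eq_zero fun i _ => by
            rw [show c (Fin.castSucc i) = 0 from congr_fun hc' i, zero_smul]
        rw [hu, mulVec_zero, dotProduct_zero]
      · exact (quadForm_sum_pos G rel S hG hprop k (fun i => τ (Fin.castSucc i))
          (fun i => v (Fin.castSucc i)) (fun j => hS _)
          (fun i j hij => hchain _ _ (Fin.castSucc_lt_castSucc_iff.2 hij)) (fun j => hker _)
          (hli.comp Fin.castSucc (Fin.castSucc_injective k)) _ hc' (τ (Fin.last k)) hT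
          (fun j => hchain _ _ (Fin.castSucc_lt_last j))).le
    exact hprop _ hT s hs (hrel _) _ hw hformT

/-- **Directed chain ⇒ linear independence.**  Under the propagation hypothesis, nonzero kernel vectors
`v j` of `G (τ j)` at times `τ j ∈ S` with `rel (τ i) (τ j)` for `i < j` are linearly independent.
[folklore] (via the tree's abstract chain lemma `VLawChain.linearIndependent_of_chain`) -/
theorem linearIndependent_of_directed [DecidableEq ι] (G : ℝ → Matrix ι ι ℝ) (rel : ℝ → ℝ → Prop)
    (S : Set ℝ) (hG : ∀ s ∈ S, (G s).IsSymm)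
    (hprop : ∀ s ∈ S, ∀ t ∈ S, rel s t → ∀ x : ι → ℝ, x ≠ 0 →
      0 ≤ x ⬝ᵥ (G s *ᵥ x) → 0 < x ⬝ᵥ (G t *ᵥ x))
    {k : ℕ} (τ : Fin k → ℝ) (v : Fin k → (ι → ℝ)) (hS : ∀ j, τ j ∈ S)
    (hchain : ∀ i j : Fin k, i < j → rel (τ i) (τ j)) (hv0 : ∀ j, v j ≠ 0)
    (hker : ∀ j, G (τ j) *ᵥ v j = 0) : LinearIndependent ℝ v := by
  refine VLawChain.linearIndependent_of_chain G τ v hv0 hker fun j hj hli c hc => ?_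
  exact quadForm_sum_pos G rel S hG hprop j (fun i => τ (Fin.castLE hj.le i))
    (fun i => v (Fin.castLE hj.le i)) (fun i => hS _)
    (fun i i' h => hchain _ _ (Fin.strictMono_castLE hj.le h)) (fun i => hker _) hli c hc
    (τ ⟨j, hj⟩) (hS _) (fun i => hchain _ _ (Fin.lt_def.2 (show (Fin.castLE hj.le i).val < j from i.isLt)))

/-- **Directed chain ⇒ count.**  Under the propagation hypothesis, a chain of `k` kernel times in `S` (ordered by
`rel`, with nonzero kernel vectors) has `k ≤ card ι`. [folklore] -/
theorem card_le_of_directed [DecidableEq ι] (G : ℝ → Matrix ι ι ℝ) (rel : ℝ → ℝ → Prop)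
    (S : Set ℝ) (hG : ∀ s ∈ S, (G s).IsSymm)
    (hprop : ∀ s ∈ S, ∀ t ∈ S, rel s t → ∀ x : ι → ℝ, x ≠ 0 →
      0 ≤ x ⬝ᵥ (G s *ᵥ x) → 0 < x ⬝ᵥ (G t *ᵥ x))
    {k : ℕ} (τ : Fin k → ℝ) (hS : ∀ j, τ j ∈ S) (hchain : ∀ i j : Fin k, i < j → rel (τ i) (τ j))
    (hdet : ∀ j, (G (τ j)).det = 0) : k ≤ Fintype.card ι := by
  have hdata : ∀ j, ∃ v : ι → ℝ, v ≠ 0 ∧ G (τ j) *ᵥ v = 0 := fun j =>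
    Matrix.exists_mulVec_eq_zero_iff.2 (hdet j)
  choose v hv0 hker using hdata
  have hli := linearIndependent_of_directed G rel S hG hprop τ v hS hchain hv0 hker
  have h := hli.fintype_card_le_finrank
  rwa [Fintype.card_fin, Module.finrank_fintype_fun_eq_card] at h

end Engine

/-! ## The H-form of a pivot pencil and the convexity of its Rayleigh forms -/

section HForm

variable {ι κ : Type} [Fintype ι] [Fintype κ]

omit [Fintype ι] in
/-- The H-form `H(x) = J + ∑ k, (x^{d k}/x^e) • P k` recovers the pencil: `x^e • H(x) = x^e J + ∑ x^{d k} P k`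
for `x ≠ 0`. [folklore] -/
theorem smul_hform (e : ℕ) (d : κ → ℕ) (J : Matrix ι ι ℝ) (P : κ → Matrix ι ι ℝ) {x : ℝ} (hx : x ≠ 0) :
    x ^ e • (J + ∑ k, (x ^ d k / x ^ e) • P k) = x ^ e • J + ∑ k, x ^ d k • P k := by
  rw [smul_add, Finset.smul_sum]
  congr 1
  refine Finset.sum_congr rfl fun k _ => ?_
  rw [smul_smul, mul_div_cancel₀ _ (pow_ne_zero e hx)]

/-- At a nonzero point, `det H(x) = 0` iff `x` is a root of `det (X^e J + ∑ X^{d k} P k)`. [folklore] -/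
theorem det_hform_eq_zero_iff [DecidableEq ι] (e : ℕ) (d : κ → ℕ) (J : Matrix ι ι ℝ) (P : κ → Matrix ι ι ℝ) {x : ℝ}
    (hx : x ≠ 0) :
    (J + ∑ k, (x ^ d k / x ^ e) • P k).det = 0 ↔
      (Matrix.det (((Polynomial.X : Polynomial ℝ) ^ e) • J.map Polynomial.C
        + ∑ k, ((Polynomial.X : Polynomial ℝ) ^ d k) • (P k).map Polynomial.C)).eval x = 0 := by
  rw [StubReverse.eval_det_pencil, ← smul_hform e d J P hx, Matrix.det_smul, mul_eq_zero]
  constructor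
  · exact fun h => Or.inr h
  · rintro (h | h)
    · exact absurd h (pow_ne_zero _ (pow_ne_zero _ hx))
    · exact h

/-- The Rayleigh form of the H-form: `vᵀH(x)v = vᵀJv + ∑ k, (x^{d k}/x^e)·vᵀP_k v`. [folklore] -/
theorem form_hform (e : ℕ) (d : κ → ℕ) (J : Matrix ι ι ℝ) (P : κ → Matrix ι ι ℝ) (v : ι → ℝ) (x : ℝ) :
    v ⬝ᵥ ((J + ∑ k, (x ^ d k / x ^ e) • P k) *ᵥ v)
      = v ⬝ᵥ (J *ᵥ v) + ∑ k, (x ^ d k / x ^ e) * (v ⬝ᵥ (P k *ᵥ v)) := by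
  rw [Matrix.add_mulVec, Matrix.sum_mulVec, dotProduct_add, dotProduct_sum]
  simp only [Matrix.smul_mulVec, dotProduct_smul, smul_eq_mul]

omit [Fintype ι] in
/-- The H-form is symmetric when `J` is symmetric and the `P k` are positive semidefinite. [folklore] -/
theorem isSymm_hform (e : ℕ) (d : κ → ℕ) {J : Matrix ι ι ℝ} {P : κ → Matrix ι ι ℝ} (hJ : J.IsSymm)
    (hP : ∀ k, (P k).PosSemidef) (x : ℝ) : (J + ∑ k, (x ^ d k / x ^ e) • P k).IsSymm := by
  have hPk : ∀ k, (P k).IsSymm := fun k => Matrix.isHermitian_iff_isSymm.1 (hP k).1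
  unfold Matrix.IsSymm
  rw [Matrix.transpose_add, Matrix.transpose_sum, hJ.eq]
  congr 1
  exact Finset.sum_congr rfl fun k _ => by rw [Matrix.transpose_smul, (hPk k).eq]

/-- Three-point secant inequality for the integer power `x ↦ x^d/x^e` on `(0, ∞)` (convexity of `zpow`):
for `0 < x < y < z`, `(z − x)·(y^d/y^e) ≤ (z − y)·(x^d/x^e) + (y − x)·(z^d/z^e)`. [folklore] -/
theorem secant_powDiv (d e : ℕ) {x y z : ℝ} (hx : 0 < x) (hxy : x < y) (hyz : y < z) :
    (z - x) * (y ^ d / y ^ e) ≤ (z - y) * (x ^ d / x ^ e) + (y - x) * (z ^ d / z ^ e) := by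
  have hconv := (convexOn_zpow ((d : ℤ) - (e : ℤ)) : ConvexOn ℝ (Set.Ioi (0 : ℝ)) fun t : ℝ => t ^ ((d : ℤ) - e))
  have hy : 0 < y := hx.trans hxy
  have hz : 0 < z := hy.trans hyz
  have key := hconv.secant_mono_aux1 (x := x) (y := y) (z := z) hx hz hxy hyz
  have hrew : ∀ t : ℝ, 0 < t → t ^ ((d : ℤ) - e) = t ^ d / t ^ e := fun t ht => by
    rw [zpow_sub₀ ht.ne', zpow_natCast, zpow_natCast]
  simp only [hrew x hx, hrew y hy, hrew z hz] at key
  exact key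

/-- **Convexity of the Rayleigh forms** (three-point form): for `Pₖ ⪰ 0`, ANY `J`, every `v` and `0 < x < y < z`,
`(z − x)·φ_v(y) ≤ (z − y)·φ_v(x) + (y − x)·φ_v(z)` where `φ_v(t) = vᵀH(t)v`. [folklore] -/
theorem secant_form (e : ℕ) (d : κ → ℕ) (J : Matrix ι ι ℝ) {P : κ → Matrix ι ι ℝ}
    (hP : ∀ k, (P k).PosSemidef) (v : ι → ℝ) {x y z : ℝ} (hx : 0 < x) (hxy : x < y) (hyz : y < z) :
    (z - x) * (v ⬝ᵥ ((J + ∑ k, (y ^ d k / y ^ e) • P k) *ᵥ v))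
      ≤ (z - y) * (v ⬝ᵥ ((J + ∑ k, (x ^ d k / x ^ e) • P k) *ᵥ v))
        + (y - x) * (v ⬝ᵥ ((J + ∑ k, (z ^ d k / z ^ e) • P k) *ᵥ v)) := by
  have hq : ∀ k, 0 ≤ v ⬝ᵥ (P k *ᵥ v) := fun k => by
    simpa only [star_trivial] using (hP k).dotProduct_mulVec_nonneg v
  simp only [form_hform]
  have hterm : ∀ k, (z - x) * ((y ^ d k / y ^ e) * (v ⬝ᵥ (P k *ᵥ v)))
      ≤ (z - y) * ((x ^ d k / x ^ e) * (v ⬝ᵥ (P k *ᵥ v)))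
        + (y - x) * ((z ^ d k / z ^ e) * (v ⬝ᵥ (P k *ᵥ v))) := by
    intro k
    have h := mul_le_mul_of_nonneg_right (secant_powDiv (d k) e hx hxy hyz) (hq k)
    nlinarith [h]
  have hsum := Finset.sum_le_sum fun k (_ : k ∈ Finset.univ) => hterm k
  rw [Finset.sum_add_distrib] at hsum
  have e1 : (z - x) * (v ⬝ᵥ (J *ᵥ v)) = (z - y) * (v ⬝ᵥ (J *ᵥ v)) + (y - x) * (v ⬝ᵥ (J *ᵥ v)) := by ring
  rw [mul_add, mul_add, mul_add, Finset.mul_sum, Finset.mul_sum, Finset.mul_sum, e1]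
  linarith [hsum]

/-- **Propagation above the negative moment.**  If `vᵀH(x₀)v < 0` for all `v ≠ 0`, then for `x₀ < y < z` and
`v ≠ 0`: `vᵀH(y)v ≥ 0 ⇒ vᵀH(z)v > 0`. [folklore] -/
theorem propagate_above (e : ℕ) (d : κ → ℕ) (J : Matrix ι ι ℝ) {P : κ → Matrix ι ι ℝ}
    (hP : ∀ k, (P k).PosSemidef) {x₀ : ℝ} (hx₀ : 0 < x₀)
    (hneg : ∀ v : ι → ℝ, v ≠ 0 → v ⬝ᵥ ((J + ∑ k, (x₀ ^ d k / x₀ ^ e) • P k) *ᵥ v) < 0)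
    {y z : ℝ} (hy : x₀ < y) (hz : y < z) (v : ι → ℝ) (hv : v ≠ 0)
    (hvy : 0 ≤ v ⬝ᵥ ((J + ∑ k, (y ^ d k / y ^ e) • P k) *ᵥ v)) :
    0 < v ⬝ᵥ ((J + ∑ k, (z ^ d k / z ^ e) • P k) *ᵥ v) := by
  have h := secant_form e d J hP v hx₀ hy hz
  have h0 := hneg v hv
  by_contra hle
  push Not at hle
  nlinarith [mul_nonneg (sub_pos.2 (hy.trans hz)).le hvy, mul_pos (sub_pos.2 hz) (neg_pos.2 h0),
    mul_nonpos_iff.2 (Or.inl ⟨(sub_pos.2 hy).le, hle⟩)]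

/-- **Propagation below the negative moment.**  If `vᵀH(x₀)v < 0` for all `v ≠ 0`, then for `0 < z < y < x₀`
and `v ≠ 0`: `vᵀH(y)v ≥ 0 ⇒ vᵀH(z)v > 0`. [folklore] -/
theorem propagate_below (e : ℕ) (d : κ → ℕ) (J : Matrix ι ι ℝ) {P : κ → Matrix ι ι ℝ}
    (hP : ∀ k, (P k).PosSemidef) {x₀ : ℝ}
    (hneg : ∀ v : ι → ℝ, v ≠ 0 → v ⬝ᵥ ((J + ∑ k, (x₀ ^ d k / x₀ ^ e) • P k) *ᵥ v) < 0)
    {y z : ℝ} (hz0 : 0 < z) (hz : z < y) (hy : y < x₀) (v : ι → ℝ) (hv : v ≠ 0)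
    (hvy : 0 ≤ v ⬝ᵥ ((J + ∑ k, (y ^ d k / y ^ e) • P k) *ᵥ v)) :
    0 < v ⬝ᵥ ((J + ∑ k, (z ^ d k / z ^ e) • P k) *ᵥ v) := by
  have h := secant_form e d J hP v hz0 hz hy
  have h0 := hneg v hv
  by_contra hle
  push Not at hle
  nlinarith [mul_nonneg (sub_pos.2 (hz.trans hy)).le hvy, mul_pos (sub_pos.2 hz) (neg_pos.2 h0),
    mul_nonpos_iff.2 (Or.inl ⟨(sub_pos.2 hy).le, hle⟩)]

/-- The negative moment in H-form: if `vᵀF(x₀)v < 0` for `v ≠ 0` then `vᵀH(x₀)v < 0` for `v ≠ 0`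
(`F(x₀) = x₀^e • H(x₀)`, `x₀ > 0`). [folklore] -/
theorem hform_neg_of_neg (e : ℕ) (d : κ → ℕ) (J : Matrix ι ι ℝ) (P : κ → Matrix ι ι ℝ) {x₀ : ℝ}
    (hx₀ : 0 < x₀) (hneg : ∀ v : ι → ℝ, v ≠ 0 → v ⬝ᵥ ((x₀ ^ e • J + ∑ k, x₀ ^ d k • P k) *ᵥ v) < 0)
    (v : ι → ℝ) (hv : v ≠ 0) : v ⬝ᵥ ((J + ∑ k, (x₀ ^ d k / x₀ ^ e) • P k) *ᵥ v) < 0 := by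
  have h := hneg v hv
  rw [← smul_hform e d J P hx₀.ne', Matrix.smul_mulVec, dotProduct_smul, smul_eq_mul] at h
  exact (mul_neg_iff.1 h).elim (fun h' => h'.2) fun h' => absurd h'.1 (not_lt.2 (pow_pos hx₀ e).le)

end HForm

end MomentLaw

open MomentLaw

section Law

variable (ι κ : Type) [Fintype ι] [DecidableEq ι] [Fintype κ]

/-- **No root at the negative moment**: if `F(x₀) ≺ 0` then `x₀` is not a zero of `det F`. [folklore] -/
theorem negMoment_not_isRoot (e : ℕ) (d : κ → ℕ) (J : Matrix ι ι ℝ) (P : κ → Matrix ι ι ℝ) {x₀ : ℝ}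
    (hx₀ : 0 < x₀) (hneg : ∀ v : ι → ℝ, v ≠ 0 → v ⬝ᵥ ((x₀ ^ e • J + ∑ k, x₀ ^ d k • P k) *ᵥ v) < 0) :
    ¬ (Matrix.det (((Polynomial.X : Polynomial ℝ) ^ e) • J.map Polynomial.C
        + ∑ k, ((Polynomial.X : Polynomial ℝ) ^ d k) • (P k).map Polynomial.C)).IsRoot x₀ := by
  intro hroot
  have hdet : (J + ∑ k, (x₀ ^ d k / x₀ ^ e) • P k).det = 0 :=
    (det_hform_eq_zero_iff e d J P hx₀.ne').2 hroot
  obtain ⟨v, hv, hHv⟩ := Matrix.exists_mulVec_eq_zero_iff.2 hdet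
  have h := hform_neg_of_neg e d J P hx₀ hneg v hv
  rw [hHv, dotProduct_zero] at h
  exact lt_irrefl 0 h

/-- **Negative-moment law, upper half**: if `F(x₀) ≺ 0` (`x₀ > 0`), then `det (X^e J + ∑ X^{d k} P k)` (`J` symmetric,
`P k ⪰ 0`, any exponents) has at most `card ι` distinct zeros in `(x₀, ∞)`. [folklore] -/
theorem negMoment_posRoots_above_le (e : ℕ) (d : κ → ℕ) (J : Matrix ι ι ℝ) (P : κ → Matrix ι ι ℝ)
    (hJ : J.IsSymm) (hP : ∀ k, (P k).PosSemidef) {x₀ : ℝ} (hx₀ : 0 < x₀)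
    (hneg : ∀ v : ι → ℝ, v ≠ 0 → v ⬝ᵥ ((x₀ ^ e • J + ∑ k, x₀ ^ d k • P k) *ᵥ v) < 0) :
    ((Matrix.det (((Polynomial.X : Polynomial ℝ) ^ e) • J.map Polynomial.C
        + ∑ k, ((Polynomial.X : Polynomial ℝ) ^ d k) • (P k).map Polynomial.C)).roots.toFinset.filter
          (fun t => x₀ < t)).card ≤ Fintype.card ι := by
  set p := Matrix.det (((Polynomial.X : Polynomial ℝ) ^ e) • J.map Polynomial.C
        + ∑ k, ((Polynomial.X : Polynomial ℝ) ^ d k) • (P k).map Polynomial.C) with hp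
  by_cases hdet : p = 0
  · simp [hdet]
  set R := p.roots.toFinset.filter (fun t => x₀ < t) with hR
  let τ : Fin R.card ↪o ℝ := R.orderEmbOfFin rfl
  have hτmem : ∀ j, τ j ∈ R := fun j => R.orderEmbOfFin_mem rfl j
  have hτgt : ∀ j, x₀ < τ j := fun j => (Finset.mem_filter.1 (hτmem j)).2
  have hτroot : ∀ j, p.IsRoot (τ j) := fun j => by
    have h1 := (Finset.mem_filter.1 (hτmem j)).1
    rw [Multiset.mem_toFinset] at h1
    exact (Polynomial.mem_roots hdet).1 h1
  have hneg' := hform_neg_of_neg e d J P hx₀ hneg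
  refine card_le_of_directed (fun x => J + ∑ k, (x ^ d k / x ^ e) • P k) (fun s t => s < t) (Set.Ioi x₀)
    (fun s _ => isSymm_hform e d hJ hP s) ?_ τ (fun j => hτgt j) (fun i j hij => τ.strictMono hij) ?_
  · intro s hs t _ hst x hx hsx
    exact propagate_above e d J hP hx₀ hneg' hs hst x hx hsx
  · intro j
    exact (det_hform_eq_zero_iff e d J P (hx₀.trans (hτgt j)).ne').2 (hτroot j)

/-- **Negative-moment law, lower half**: if `F(x₀) ≺ 0` (`x₀ > 0`), then `det (X^e J + ∑ X^{d k} P k)` has at most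
`card ι` distinct zeros in `(0, x₀)`. [folklore] -/
theorem negMoment_posRoots_below_le (e : ℕ) (d : κ → ℕ) (J : Matrix ι ι ℝ) (P : κ → Matrix ι ι ℝ)
    (hJ : J.IsSymm) (hP : ∀ k, (P k).PosSemidef) {x₀ : ℝ} (hx₀ : 0 < x₀)
    (hneg : ∀ v : ι → ℝ, v ≠ 0 → v ⬝ᵥ ((x₀ ^ e • J + ∑ k, x₀ ^ d k • P k) *ᵥ v) < 0) :
    ((Matrix.det (((Polynomial.X : Polynomial ℝ) ^ e) • J.map Polynomial.C
        + ∑ k, ((Polynomial.X : Polynomial ℝ) ^ d k) • (P k).map Polynomial.C)).roots.toFinset.filter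
          (fun t => 0 < t ∧ t < x₀)).card ≤ Fintype.card ι := by
  set p := Matrix.det (((Polynomial.X : Polynomial ℝ) ^ e) • J.map Polynomial.C
        + ∑ k, ((Polynomial.X : Polynomial ℝ) ^ d k) • (P k).map Polynomial.C) with hp
  by_cases hdet : p = 0
  · simp [hdet]
  set R := p.roots.toFinset.filter (fun t => 0 < t ∧ t < x₀) with hR
  let σ : Fin R.card ↪o ℝ := R.orderEmbOfFin rfl
  -- enumerate DEcreasingly: away from `x₀` means towards `0`
  let τ : Fin R.card → ℝ := fun j => σ (Fin.rev j)
  have hτmem : ∀ j, τ j ∈ R := fun j => R.orderEmbOfFin_mem rfl (Fin.rev j)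
  have hτpos : ∀ j, 0 < τ j := fun j => (Finset.mem_filter.1 (hτmem j)).2.1
  have hτlt : ∀ j, τ j < x₀ := fun j => (Finset.mem_filter.1 (hτmem j)).2.2
  have hτroot : ∀ j, p.IsRoot (τ j) := fun j => by
    have h1 := (Finset.mem_filter.1 (hτmem j)).1
    rw [Multiset.mem_toFinset] at h1
    exact (Polynomial.mem_roots hdet).1 h1
  have hτanti : ∀ i j : Fin R.card, i < j → τ j < τ i := fun i j hij =>
    σ.strictMono (Fin.rev_lt_rev.2 hij)
  have hneg' := hform_neg_of_neg e d J P hx₀ hneg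
  refine card_le_of_directed (fun x => J + ∑ k, (x ^ d k / x ^ e) • P k) (fun s t => t < s)
    (Set.Ioo 0 x₀) (fun s _ => isSymm_hform e d hJ hP s) ?_ τ (fun j => ⟨hτpos j, hτlt j⟩) hτanti ?_
  · intro s hs t ht hts x hx hsx
    exact propagate_below e d J hP hneg' ht.1 hts hs.2 x hx hsx
  · intro j
    exact (det_hform_eq_zero_iff e d J P (hτpos j).ne').2 (hτroot j)

/-- **THE NEGATIVE-MOMENT LAW.**  `F(X) = X^e J + ∑ k, X^{d k} P k` with `J` real symmetric, every `P k ⪰ 0`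
(any finite letter type, any exponents on both sides of `e`).  If `F(x₀)` is negative definite at one scale
`x₀ > 0` (`vᵀF(x₀)v < 0` for all `v ≠ 0`), then `det F` has at most `2 · card ι` distinct positive zeros — at most
`card ι` on each side of `x₀` and none at `x₀`.  Sharp; K-free; the hypothesis forces `J ≺ 0`. [folklore] -/
theorem negMoment_posRoots_le (e : ℕ) (d : κ → ℕ) (J : Matrix ι ι ℝ) (P : κ → Matrix ι ι ℝ)
    (hJ : J.IsSymm) (hP : ∀ k, (P k).PosSemidef) (x₀ : ℝ) (hx₀ : 0 < x₀)
    (hneg : ∀ v : ι → ℝ, v ≠ 0 → v ⬝ᵥ ((x₀ ^ e • J + ∑ k, x₀ ^ d k • P k) *ᵥ v) < 0) :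
    ((Matrix.det (((Polynomial.X : Polynomial ℝ) ^ e) • J.map Polynomial.C
        + ∑ k, ((Polynomial.X : Polynomial ℝ) ^ d k) • (P k).map Polynomial.C)).roots.toFinset.filter
          (fun t => 0 < t)).card ≤ 2 * Fintype.card ι := by
  set p := Matrix.det (((Polynomial.X : Polynomial ℝ) ^ e) • J.map Polynomial.C
        + ∑ k, ((Polynomial.X : Polynomial ℝ) ^ d k) • (P k).map Polynomial.C) with hp
  have hsplit : p.roots.toFinset.filter (fun t => 0 < t)
      ⊆ p.roots.toFinset.filter (fun t => 0 < t ∧ t < x₀) ∪ p.roots.toFinset.filter (fun t => x₀ < t) := by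
    intro t ht
    rw [Finset.mem_filter] at ht
    rw [Finset.mem_union, Finset.mem_filter, Finset.mem_filter]
    rcases lt_trichotomy t x₀ with h | h | h
    · exact Or.inl ⟨ht.1, ht.2, h⟩
    · exfalso
      subst h
      have hmem := ht.1
      rw [Multiset.mem_toFinset] at hmem
      by_cases hdet : p = 0
      · rw [hdet, Polynomial.roots_zero] at hmem
        exact Multiset.notMem_zero _ hmem
      · exact negMoment_not_isRoot ι κ e d J P ht.2 hneg ((Polynomial.mem_roots hdet).1 hmem)
    · exact Or.inr ⟨ht.1, h⟩
  calc (p.roots.toFinset.filter (fun t => 0 < t)).card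
      ≤ (p.roots.toFinset.filter (fun t => 0 < t ∧ t < x₀) ∪ p.roots.toFinset.filter (fun t => x₀ < t)).card :=
        Finset.card_le_card hsplit
    _ ≤ (p.roots.toFinset.filter (fun t => 0 < t ∧ t < x₀)).card
          + (p.roots.toFinset.filter (fun t => x₀ < t)).card := Finset.card_union_le _ _
    _ ≤ Fintype.card ι + Fintype.card ι :=
        Nat.add_le_add (negMoment_posRoots_below_le ι κ e d J P hJ hP hx₀ hneg)
          (negMoment_posRoots_above_le ι κ e d J P hJ hP hx₀ hneg)
    _ = 2 * Fintype.card ι := by ring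

omit [DecidableEq ι] in
/-- **The hypothesis forces a negative definite pivot**: if `F(x₀) ≺ 0` at some `x₀ > 0` then `vᵀJv < 0` for all
`v ≠ 0` (the PSD letters only add). [folklore] -/
theorem negMoment_pivot_neg (e : ℕ) (d : κ → ℕ) (J : Matrix ι ι ℝ) (P : κ → Matrix ι ι ℝ)
    (hP : ∀ k, (P k).PosSemidef) {x₀ : ℝ} (hx₀ : 0 < x₀)
    (hneg : ∀ v : ι → ℝ, v ≠ 0 → v ⬝ᵥ ((x₀ ^ e • J + ∑ k, x₀ ^ d k • P k) *ᵥ v) < 0)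
    (v : ι → ℝ) (hv : v ≠ 0) : v ⬝ᵥ (J *ᵥ v) < 0 := by
  have h := hform_neg_of_neg e d J P hx₀ hneg v hv
  rw [form_hform] at h
  have hq : ∀ k, 0 ≤ (x₀ ^ d k / x₀ ^ e) * (v ⬝ᵥ (P k *ᵥ v)) := fun k =>
    mul_nonneg (div_nonneg (pow_pos hx₀ _).le (pow_pos hx₀ _).le)
      (by simpa only [star_trivial] using (hP k).dotProduct_mulVec_nonneg v)
  linarith [Finset.sum_nonneg fun k (_ : k ∈ Finset.univ) => hq k]

end Law

end Summit.ValiantsHypothesis.ValiantsHypothesis.Theorems.LacunarySymmetroidMatrixDescartes
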